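import Summits.MatrixMultiplication.MatrixMultiplication.Theorems.SaturationLadderClauseGerm
import Summits.MatrixMultiplication.MatrixMultiplication.Theorems.FarEdgeDescentIsolatedTower
import Summits.MatrixMultiplication.OmegaCensus.RectangularExponentRealScalarExtension
import Literature.Computability.AlgebraicComplexity.RectangularExponentSubadditivity
import HarnessLib

/-!
# Route `SaturationLadder` on Strassen's spectrum, XII: HEIGHT–EXCESS DUALITY of a thin clause

decomp-mm lens 1 «grading / quantitative ladder», gen 47, kernel K47-D (chain file 12; companions: file 2
`SaturationLadderThinRoof`, file 9 `SaturationLadderHeightCeiling`, file 10 `SaturationLadderClauseGerm`).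
Def-free, sorry-free support beneath the deciding crux `SubexpSaturation` (stmt-MatrixMultiplication-25909) of
`route-MatrixMultiplication-SaturationLadder`; cut of record UNCHANGED:
`closes (h₁ : SubexpSaturation) (h₂ : SubexpToPoly) (h₃ : PolyToFinite) (h₄ : TailDescentTwo) (h₅ : SquareFromTwo)`.

Notation: universal spectral point `φ`, `θ = specMMPoint K φ ∈ [0,1]³`, height `θ₁`, depths `εᵢ = 1 − θᵢ`; the thin
format `(1,t,R)` has the information floor `ω(1,t,R) ≥ 1+R` and **`e(t,R) := ω(1,t,R) − (1+R) ≥ 0` is its THIN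
EXCESS**; the thin clause `ω(1,t,R) ≤ 1+R` of the crux is the ROOF `t·θ₁ ≤ ε₀ + R·ε₂` at every universal `φ`
(file 2, `thinTight_iff_roof`); a VIOLATOR of the roof `(t,R)` is a universal `φ` with `t·θ₁ > ε₀ + R·ε₂`.
File 9 bounded violator heights by `R^{−θ}` through the cusp modulus law, for `R = e^{c/(1−t)}` and `t ≥ t₁(c)`
(ineffective).  This file replaces the detour by a two-line DUALITY valid at EVERY `t` and EVERY real `R ≥ 0`, in
both directions, over every field — so that HEIGHT CEILING and THIN EXCESS are provably ONE grade:
* §2 ★★ `height_lt_excess`: a violator of the roof `(t,R)` has `(t'−t)·θ₁ < e(t',R)` for every `t' ≥ 0`; hence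
  `(1−t)·θ₁ < e(1,k) = ω(1,k,1) − (k+1)` for every real `0 ≤ k ≤ R` (`height_lt_farExcess`).
* §3 ★★ `excess_le_of_roofAbove`: if the roof `(t,R)` holds at every universal point of height `≥ H ≥ 0` then
  `e(t,R) ≤ t·H`; an excess `> t·H` is WITNESSED by a violator of height `≥ H` (`exists_violator_of_excess`);
  `excess_eq_zero_iff_roof`.  So `e(t,R)/t ≤ sup{θ₁ : φ violates (t,R)} ≤ inf_{t'>t} e(t',R)/(t'−t)`.
* §4 ★★ EFFECTIVE, THRESHOLD-FREE CEILINGS: `∀k≥1: e(1,k) ≤ C·k^{−ρ}` gives `(1−t)·θ₁ < C·⌊R⌋^{−ρ}` at every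
  violator of every roof `(t,R)`, `R ≥ 1` (`violatorHeight_lt_of_farRate`); `RateBeyond θ ⟹ (1−t)·θ₁ < C'·R^{−θ}`
  (`violatorHeight_of_rateBeyond`).  RECORD after route `FarEdgeDescent`'s kernel XXXII-D
  (`FarEdgeDescentIsolatedTower.rateBeyond_isolatedTower`: Schönhage's `E₃` with an isolated anchor in the certified
  improvable squaring tower, unconditional, every field): **for EVERY `0 ≤ θ < θ_S = log(4/3)/log(3/2) = 0.70951…`,
  `θ₁ < C_θ·R^{−θ}/(1−t)` at every violator of every roof `(t,R)`, `R ≥ 1`** (`violatorHeight_isolatedTower`);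
  file 9's threshold form at the record (`heightCeiling_isolatedTower`; file 9 had `θ < 0.4486`).
* §5 walls of record moved by XXXII-D (one-liners): the cusp modulus law on every cusp `ε₂ ≤ θ₁^{1+δ}`,
  `δ ≥ 1/θ`, `θ < θ_S` — every `δ > 1/θ_S = 1.4094…` (`cuspModulus_isolatedTower`; files 7/8: `δ > 2.229`); over `ℂ`
  `SubexpSaturation ⟺` the roofs `(t,R)` at the universal points of height `< R^{−θ}` only, every `θ < θ_S`
  (`subexpSaturation_iff_roofBelowCeiling_isolatedTower`).
* §6 ★ CONVEXITY CHORD (Lotti–Romani joint convexity): a roof at `(t₀,R)` gives `e(t,R) ≤ ((t−t₀)/(1−t₀))·e(1,R)`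
  on `[t₀,1]` (`excess_le_chord`); over `ℂ`, from the corner roof above the class ceiling `c₂ = (5log(5/4)+3log2)/3`
  (file 3): `e(t,R) ≤ (1 − (1−t)·log R/c')·e(1,R)` for `c' > c₂`, `R ≥ R₀(c')` (`thinExcess_le_classChord`) — along
  the crux's curve `R = e^{c/(1−t)}` the thin excess is at most the fraction `1 − c/c'` of the far excess.
READING (the lens's typed leaf): by §2–§3 the lineage's IDEA-NEEDED node — "a law for the universal points of height
in `[R^{−A}, R^{−θ_S})`" — is EQUIVALENTLY a THIN-EXCESS DECAY `e(1−s, e^{c/s}) ≤ e^{−A·c/s}`, `A > θ_S`, a statement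
about `ω` alone that any rectangular certificate can be tested against.  Nothing here proves `ω = 2` or an open
item; no definitions (gate rule D-0009).  [cite: Strassen1988, Thm. 3.8] [cite: LottiRomani1983, §1 (p. 173); Thm. 2;
Prop. 4.1] [cite: Pan1984, Thm. 17.1] [cite: Schonhage1981, §5] [cite: AlmanLi2026, Proposition 4.2]
[cite: CoppersmithWinograd1990, §8]
-/

set_option linter.dupNamespace false

noncomputable section

namespace Summit.MatrixMultiplication.MatrixMultiplication.Theorems.SaturationLadderHeightExcess

open Literature.Computability.AlgebraicComplexity
open Summit.MatrixMultiplication.MatrixMultiplication.Theses.SaturationLadder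
open Summit.MatrixMultiplication.OmegaCensus (omegaRect_mono₂)
open Summit.MatrixMultiplication.MatrixMultiplication.Theorems.SaturationLadderThinRoof
  (plane_le_omegaRect isLUB_plane thinTight_iff_roof roof_mono)
open Summit.MatrixMultiplication.MatrixMultiplication.Theorems.SaturationLadderCornerGerm
  (cornerRoof_above_classCeiling)
open Summit.MatrixMultiplication.MatrixMultiplication.Theorems.SaturationLadderCuspModulus
  (cuspModulus_of_rateBeyond)
open Summit.MatrixMultiplication.MatrixMultiplication.Theorems.SaturationLadderHeightCeiling
  (heightCeiling_of_rateBeyond)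
open Summit.MatrixMultiplication.MatrixMultiplication.Theorems.SaturationLadderClauseGerm
  (subexpSaturation_iff_roofBelowCeiling_of_rateBeyond)
open Summit.MatrixMultiplication.MatrixMultiplication.Theorems.FarEdgeDescentIsolatedTower (rateBeyond_isolatedTower)

variable {K : Type} [Field K]

/-! ## §1 The thin excess -/

/-- **The thin excess is non-negative**: `1 + R ≤ ω(1,t,R)` (information bound in slots one and three).
[cite: LottiRomani1983, Thm. 2] -/
theorem excess_nonneg (t R : ℝ) : 0 ≤ omegaRect K 1 t R - (1 + R) :=
  sub_nonneg.2 (add_le_omegaRect₁₃ K 1 t R)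

/-- **The thin excess is monotone in the weight**: `t ≤ t' ⟹ e(t,R) ≤ e(t',R)` (padding in the middle slot, the
ω-census tool file's `omegaRect_mono₂`). [folklore] -/
theorem excess_mono {t t' : ℝ} (h : t ≤ t') (R : ℝ) :
    omegaRect K 1 t R - (1 + R) ≤ omegaRect K 1 t' R - (1 + R) :=
  sub_le_sub_right (omegaRect_mono₂ K h) _

/-- **The far excess in two readings**: `ω(1,1,k) − (1+k) = ω(1,k,1) − (k+1)` (`ω(1,1,k) = ω(1,k,1)`).
[cite: LottiRomani1983, Thm. 1] -/
theorem farExcess_swap (k : ℝ) : omegaRect K 1 1 k - (1 + k) = omegaRect K 1 k 1 - (k + 1) := by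
  rw [omegaRect_swap₂₃ K 1 1 k, add_comm 1 k]

/-! ## §2 Height < excess slope: every violator is paid for by a heavier excess -/

/-- ★★ **HEIGHT < EXCESS SLOPE** (every field): if the universal point `φ` violates the roof `(t,R)`
(`t·θ₁ > ε₀ + R·ε₂`), then for every `t' ≥ 0` (and `R ≥ 0`) `(t'−t)·θ₁ < e(t',R) = ω(1,t',R) − (1+R)`: the plane
of `φ` at `(1,t',R)` lies below `ω(1,t',R)` (file 2) while at `(1,t,R)` it lies strictly above `1+R`.
[cite: Strassen1988, Thm. 3.8] [cite: LottiRomani1983, Thm. 2] -/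
theorem height_lt_excess {F : SpectralMap K} (hF : IsUniversalSpectralPoint K F) {t t' R : ℝ} (ht' : 0 ≤ t')
    (hR : 0 ≤ R) (hv : ¬ (t * specMMPoint K F 1 ≤ (1 - specMMPoint K F 0) + R * (1 - specMMPoint K F 2))) :
    (t' - t) * specMMPoint K F 1 < omegaRect K 1 t' R - (1 + R) := by
  have h := plane_le_omegaRect hF ht' hR
  push Not at hv
  nlinarith [h, hv]

/-- ★★ **The far excess bounds the height of every violator** (every field): a violator of the roof `(t,R)` has
`(1−t)·θ₁ < e(1,k) = ω(1,k,1) − (k+1)` for every real `0 ≤ k ≤ R` (a violator of `(t,R)` violates `(t,k)` by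
`roof_mono`; then §2 at `t' = 1` and `ω(1,1,k) = ω(1,k,1)`). [cite: Strassen1988, Thm. 3.8] [cite: LottiRomani1983, Thm. 1; Thm. 2] -/
theorem height_lt_farExcess {F : SpectralMap K} (hF : IsUniversalSpectralPoint K F) {t R k : ℝ} (hk : 0 ≤ k)
    (hkR : k ≤ R) (hv : ¬ (t * specMMPoint K F 1 ≤ (1 - specMMPoint K F 0) + R * (1 - specMMPoint K F 2))) :
    (1 - t) * specMMPoint K F 1 < omegaRect K 1 k 1 - (k + 1) := by
  have hv' : ¬ (t * specMMPoint K F 1 ≤ (1 - specMMPoint K F 0) + k * (1 - specMMPoint K F 2)) :=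
    fun h => hv (roof_mono hF le_rfl hkR h)
  have h := height_lt_excess hF zero_le_one hk hv'
  rwa [farExcess_swap] at h

/-- **Contrapositive, roof form**: if `(1−t)·θ₁ ≥ e(1,k)` for some real `0 ≤ k ≤ R`, then `φ` obeys the roof `(t,R)`.
[cite: Strassen1988, Thm. 3.8] -/
theorem roof_of_farExcess_le {F : SpectralMap K} (hF : IsUniversalSpectralPoint K F) {t R k : ℝ} (hk : 0 ≤ k)
    (hkR : k ≤ R) (hh : omegaRect K 1 k 1 - (k + 1) ≤ (1 - t) * specMMPoint K F 1) :
    t * specMMPoint K F 1 ≤ (1 - specMMPoint K F 0) + R * (1 - specMMPoint K F 2) := by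
  by_contra hv
  exact absurd hh (not_le.2 (height_lt_farExcess hF hk hkR hv))

/-! ## §3 Excess ≤ weight × violator height: every excess is witnessed by a high violator -/

/-- ★★ **EXCESS ≤ t·H** (every field): if the roof `(t,R)` (`t, R ≥ 0`) holds at every universal point of height
`θ₁ ≥ H` (`H ≥ 0`), then `ω(1,t,R) ≤ 1 + R + t·H` — the points below height `H` cost at most `t·H` (their plane is
`≤ θ₀ + t·H + R·θ₂ ≤ 1 + t·H + R`), the others are on the roof; conclude by `isLUB_plane`.
[cite: Strassen1988, Thm. 3.8] [cite: AlmanLi2026, Proposition 4.2] -/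
theorem excess_le_of_roofAbove {t R H : ℝ} (ht : 0 ≤ t) (hR : 0 ≤ R) (hH : 0 ≤ H)
    (h : ∀ F : SpectralMap K, IsUniversalSpectralPoint K F → H ≤ specMMPoint K F 1 →
      t * specMMPoint K F 1 ≤ (1 - specMMPoint K F 0) + R * (1 - specMMPoint K F 2)) :
    omegaRect K 1 t R - (1 + R) ≤ t * H := by
  suffices hω : omegaRect K 1 t R ≤ 1 + R + t * H by linarith
  refine (isLUB_plane (K := K) ht hR).2 ?_
  rintro _ ⟨F, hF, rfl⟩
  show specMMPoint K F 0 + t * specMMPoint K F 1 + R * specMMPoint K F 2 ≤ 1 + R + t * H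
  have h0 := (AlmanLi2026.prop42_mem_Icc hF 0).2
  have h2 := (AlmanLi2026.prop42_mem_Icc hF 2).2
  by_cases hh : H ≤ specMMPoint K F 1
  · have := h F hF hh
    nlinarith
  · push Not at hh
    have : t * specMMPoint K F 1 ≤ t * H := mul_le_mul_of_nonneg_left hh.le ht
    nlinarith

/-- ★ **Every excess is witnessed by a high violator** (every field): if `ω(1,t,R) > 1 + R + t·H` (`t, R, H ≥ 0`)
then some universal point of height `θ₁ ≥ H` violates the roof `(t,R)`. [cite: Strassen1988, Thm. 3.8] -/
theorem exists_violator_of_excess {t R H : ℝ} (ht : 0 ≤ t) (hR : 0 ≤ R) (hH : 0 ≤ H)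
    (he : t * H < omegaRect K 1 t R - (1 + R)) :
    ∃ F : SpectralMap K, IsUniversalSpectralPoint K F ∧ H ≤ specMMPoint K F 1 ∧
      ¬ (t * specMMPoint K F 1 ≤ (1 - specMMPoint K F 0) + R * (1 - specMMPoint K F 2)) := by
  by_contra hne
  push Not at hne
  exact absurd (excess_le_of_roofAbove ht hR hH fun F hF hh => hne F hF hh) (not_le.2 he)

/-- **The roof law IS the vanishing of the excess** (`H = 0`): `(∀φ: roof (t,R)) ⟺ e(t,R) = 0` — file 2's
`thinTight_iff_roof` in excess form. [cite: Strassen1988, Thm. 3.8] -/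
theorem excess_eq_zero_iff_roof {t R : ℝ} (ht : 0 ≤ t) (hR : 0 ≤ R) :
    omegaRect K 1 t R - (1 + R) = 0 ↔ ∀ F : SpectralMap K, IsUniversalSpectralPoint K F →
      t * specMMPoint K F 1 ≤ (1 - specMMPoint K F 0) + R * (1 - specMMPoint K F 2) := by
  rw [← thinTight_iff_roof (K := K) ht hR]
  have := excess_nonneg (K := K) t R
  constructor <;> intro h <;> linarith

/-! ## §4 Effective, threshold-free height ceilings from far rates; the record `θ_S = 0.70951…` -/

/-- ★★ **EFFECTIVE CEILING FROM A FAR RATE** (every field, no threshold in `t`): if `e(1,k) ≤ C·k^{−ρ}` for all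
integers `k ≥ 1`, then every violator of every roof `(t,R)` with `R ≥ 1` has `(1−t)·θ₁ < C·⌊R⌋^{−ρ}`.
[cite: LottiRomani1983, Prop. 4.1] [cite: Strassen1988, Thm. 3.8] -/
theorem violatorHeight_lt_of_farRate {C ρ : ℝ}
    (hC : ∀ k : ℕ, 1 ≤ k → omegaRect K 1 k 1 - (k + 1) ≤ C * (k : ℝ) ^ (-ρ))
    {F : SpectralMap K} (hF : IsUniversalSpectralPoint K F) {t R : ℝ} (hR : 1 ≤ R)
    (hv : ¬ (t * specMMPoint K F 1 ≤ (1 - specMMPoint K F 0) + R * (1 - specMMPoint K F 2))) :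
    (1 - t) * specMMPoint K F 1 < C * ((⌊R⌋₊ : ℕ) : ℝ) ^ (-ρ) := by
  have hR0 : 0 ≤ R := le_trans zero_le_one hR
  have hk1 : 1 ≤ ⌊R⌋₊ := Nat.le_floor (by exact_mod_cast hR)
  have hk0 : (0 : ℝ) ≤ (⌊R⌋₊ : ℝ) := Nat.cast_nonneg _
  have hkR : ((⌊R⌋₊ : ℕ) : ℝ) ≤ R := Nat.floor_le hR0
  exact lt_of_lt_of_le (height_lt_farExcess hF hk0 hkR hv) (hC _ hk1)

/-- **Roof form**: under the far rate, the roof `(t,R)`, `R ≥ 1`, holds at every universal point of height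
`θ₁ ≥ C·⌊R⌋^{−ρ}/(1−t)` (`t < 1`). [cite: LottiRomani1983, Prop. 4.1] [cite: Strassen1988, Thm. 3.8] -/
theorem roof_of_farRate_le_height {C ρ : ℝ}
    (hC : ∀ k : ℕ, 1 ≤ k → omegaRect K 1 k 1 - (k + 1) ≤ C * (k : ℝ) ^ (-ρ))
    {F : SpectralMap K} (hF : IsUniversalSpectralPoint K F) {t R : ℝ} (ht : t < 1) (hR : 1 ≤ R)
    (hh : C * ((⌊R⌋₊ : ℕ) : ℝ) ^ (-ρ) / (1 - t) ≤ specMMPoint K F 1) :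
    t * specMMPoint K F 1 ≤ (1 - specMMPoint K F 0) + R * (1 - specMMPoint K F 2) := by
  by_contra hv
  have h := violatorHeight_lt_of_farRate hC hF hR hv
  rw [div_le_iff₀ (sub_pos.2 ht), mul_comm] at hh
  linarith

/-- Arithmetic: `⌊R⌋^{−θ} ≤ 2^θ·R^{−θ}` for `R ≥ 1`, `θ ≥ 0` (`⌊R⌋ > R/2`). [folklore] -/
theorem floor_rpow_neg_le {R θ : ℝ} (hR : 1 ≤ R) (hθ : 0 ≤ θ) :
    ((⌊R⌋₊ : ℕ) : ℝ) ^ (-θ) ≤ (2 : ℝ) ^ θ * R ^ (-θ) := by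
  have hR0 : 0 < R := lt_of_lt_of_le one_pos hR
  have hk1 : (1 : ℝ) ≤ (⌊R⌋₊ : ℝ) := by exact_mod_cast Nat.le_floor (by exact_mod_cast hR)
  have hlt : R < (⌊R⌋₊ : ℝ) + 1 := Nat.lt_floor_add_one R
  have hhalf : R / 2 ≤ (⌊R⌋₊ : ℝ) := by linarith
  have h1 : ((⌊R⌋₊ : ℕ) : ℝ) ^ (-θ) ≤ (R / 2) ^ (-θ) :=
    Real.rpow_le_rpow_of_nonpos (by positivity) hhalf (by linarith)
  have h2 : (R / 2) ^ (-θ) = (2 : ℝ) ^ θ * R ^ (-θ) := by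
    rw [Real.div_rpow hR0.le zero_le_two, Real.rpow_neg zero_le_two, div_inv_eq_mul, mul_comm]
  linarith [h2.le]

/-- ★★ **`RateBeyond θ` ⟹ violator height `O(R^{−θ})/(1−t)`, threshold-free** (every field, `θ ≥ 0`): from
`∃ ρ > θ ∃ C ∀ k ≥ 1, e(1,k) ≤ C·k^{−ρ}` there is `C' > 0` (`= max(C,1)·2^θ`) with `(1−t)·θ₁ < C'·R^{−θ}` at every
violator of every roof `(t,R)`, `R ≥ 1`, for EVERY real `t`.
(File 9's `heightCeiling_of_rateBeyond` gave `θ₁ < R^{−θ}` only for `R = e^{c/(1−t)}` and `t ≥ t₁(c)`, ineffective.)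
[cite: LottiRomani1983, Prop. 4.1] [cite: Strassen1988, Thm. 3.8] -/
theorem violatorHeight_of_rateBeyond {θ : ℝ} (hθ : 0 ≤ θ)
    (hR : ∃ ρ C : ℝ, θ < ρ ∧ ∀ k : ℕ, 1 ≤ k → omegaRect K 1 k 1 - (k + 1) ≤ C * (k : ℝ) ^ (-ρ)) :
    ∃ C' : ℝ, 0 < C' ∧ ∀ t R : ℝ, 1 ≤ R → ∀ F : SpectralMap K, IsUniversalSpectralPoint K F →
      ¬ (t * specMMPoint K F 1 ≤ (1 - specMMPoint K F 0) + R * (1 - specMMPoint K F 2)) →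
        (1 - t) * specMMPoint K F 1 < C' * R ^ (-θ) := by
  obtain ⟨ρ, C, hρ, hC⟩ := hR
  have hC' : ∀ k : ℕ, 1 ≤ k → omegaRect K 1 k 1 - (k + 1) ≤ max C 1 * (k : ℝ) ^ (-ρ) := by
    intro k hk
    have hkpos : (0 : ℝ) < (k : ℝ) ^ (-ρ) := Real.rpow_pos_of_pos (by exact_mod_cast hk) _
    exact (hC k hk).trans (mul_le_mul_of_nonneg_right (le_max_left _ _) hkpos.le)
  have hm : 0 < max C 1 := lt_of_lt_of_le one_pos (le_max_right _ _)
  refine ⟨max C 1 * (2 : ℝ) ^ θ, by positivity, fun t R hR1 F hF hv => ?_⟩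
  have h1 := violatorHeight_lt_of_farRate hC' hF hR1 hv
  have hk1 : (1 : ℝ) ≤ (⌊R⌋₊ : ℝ) := by exact_mod_cast Nat.le_floor (by exact_mod_cast hR1)
  have h2 : ((⌊R⌋₊ : ℕ) : ℝ) ^ (-ρ) ≤ ((⌊R⌋₊ : ℕ) : ℝ) ^ (-θ) :=
    Real.rpow_le_rpow_of_exponent_le hk1 (by linarith)
  have h3 := floor_rpow_neg_le hR1 hθ
  have h4 : max C 1 * ((⌊R⌋₊ : ℕ) : ℝ) ^ (-ρ) ≤ max C 1 * ((2 : ℝ) ^ θ * R ^ (-θ)) :=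
    mul_le_mul_of_nonneg_left (h2.trans h3) hm.le
  nlinarith [h1, h4]

/-- ★★ **RECORD (gen 47, after route `FarEdgeDescent` kernel XXXII-D): violator height `O(R^{−θ})/(1−t)` for EVERY
`0 ≤ θ < θ_S = log(4/3)/log(3/2) = 0.70951…`**, over every field, unconditionally, at every violator of every roof
`(t,R)`, `R ≥ 1`, every `t` (Schönhage's `E₃` with an isolated anchor in the certified improvable squaring tower:
`rateBeyond_isolatedTower`).  The thin clause of length `R` is owed only below height `C_θ·R^{−θ}/(1−t)`.
[cite: Schonhage1981, §5] [cite: Pan1984, Thm. 17.1] [cite: LottiRomani1983, Prop. 4.1] [cite: Strassen1988, Thm. 3.8] -/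
theorem violatorHeight_isolatedTower {θ : ℝ} (hθ : 0 ≤ θ)
    (hθS : θ < Real.logb 2 ((4 : ℝ) / 3) / (1 - Real.logb 2 ((4 : ℝ) / 3))) :
    ∃ C' : ℝ, 0 < C' ∧ ∀ t R : ℝ, 1 ≤ R → ∀ F : SpectralMap K, IsUniversalSpectralPoint K F →
      ¬ (t * specMMPoint K F 1 ≤ (1 - specMMPoint K F 0) + R * (1 - specMMPoint K F 2)) →
        (1 - t) * specMMPoint K F 1 < C' * R ^ (-θ) :=
  violatorHeight_of_rateBeyond hθ (rateBeyond_isolatedTower K hθS)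

/-- ★ **File 9's threshold ceiling at the new record** (every field): for every `0 < θ < θ_S` and `c > 0` there is
`t₁ < 1` such that for `t ∈ [t₁,1)` the roof of the clause `(t, R = e^{c/(1−t)})` holds at every universal point of
height `θ₁ ≥ R^{−θ} = exp(−θc/(1−t))` (file 9 had this for `θ < 0.4486…`, the crude tower's order).
[cite: Pan1984, Thm. 17.1] [cite: LottiRomani1983, Prop. 4.1] [cite: Strassen1988, Thm. 3.8] -/
theorem heightCeiling_isolatedTower {θ : ℝ} (hθ : 0 < θ)
    (hθS : θ < Real.logb 2 ((4 : ℝ) / 3) / (1 - Real.logb 2 ((4 : ℝ) / 3))) {c : ℝ} (hc : 0 < c) :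
    ∃ t₁ : ℝ, t₁ < 1 ∧ ∀ t : ℝ, t₁ ≤ t → t < 1 → ∀ F : SpectralMap K, IsUniversalSpectralPoint K F →
      Real.exp (-(θ * c / (1 - t))) ≤ specMMPoint K F 1 →
        t * specMMPoint K F 1 ≤
          (1 - specMMPoint K F 0) + Real.exp (c / (1 - t)) * (1 - specMMPoint K F 2) :=
  heightCeiling_of_rateBeyond hθ (rateBeyond_isolatedTower K hθS) hc

/-! ## §5 Walls of record moved by kernel XXXII-D (one-liners) -/

/-- ★ **Cusp modulus law on every cusp of exponent `δ ≥ 1/θ`, `θ < θ_S`** — i.e. on EVERY cusp `ε₂ ≤ θ₁^{1+δ}` with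
`δ > 1/θ_S = log(3/2)/log(4/3) = 1.4094…` (every field; files 7/8 had `δ ≥ 2.23`): for every `κ > 0` there is `u₀`
with `d·u ≤ κ·θ₁` at every universal point of the cusp with log-aspect `u ≥ u₀`.
[cite: LottiRomani1983, Prop. 4.1] [cite: Pan1984, Thm. 17.1] [cite: CoppersmithWinograd1990, §8] -/
theorem cuspModulus_isolatedTower {θ : ℝ} (hθ : 0 < θ)
    (hθS : θ < Real.logb 2 ((4 : ℝ) / 3) / (1 - Real.logb 2 ((4 : ℝ) / 3))) {δ : ℝ} (hδ : 1 / θ ≤ δ)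
    {κ : ℝ} (hκ : 0 < κ) :
    ∃ u₀ : ℝ, ∀ F : SpectralMap K, IsUniversalSpectralPoint K F → specMMPoint K F 2 < 1 →
      u₀ ≤ Real.log (specMMPoint K F 1 / (1 - specMMPoint K F 2)) →
        1 - specMMPoint K F 2 ≤ specMMPoint K F 1 ^ (1 + δ) →
          (specMMPoint K F 0 + specMMPoint K F 1 + specMMPoint K F 2 - 2) *
              Real.log (specMMPoint K F 1 / (1 - specMMPoint K F 2)) ≤ κ * specMMPoint K F 1 :=
  cuspModulus_of_rateBeyond hθ (rateBeyond_isolatedTower K hθS) hδ hκ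

/-- ★ **The crux lives below height `R^{−θ}` for every `θ < θ_S`** (over `ℂ`): `SubexpSaturation ⟺` for every
`c > 0`, eventually in `t`, the roof `(t, R = e^{c/(1−t)})` at the universal points of height `θ₁ < R^{−θ}` only.
[cite: Pan1984, Thm. 17.1] [cite: LottiRomani1983, Prop. 4.1] [cite: Strassen1988, Thm. 3.8] -/
theorem subexpSaturation_iff_roofBelowCeiling_isolatedTower {θ : ℝ} (hθ : 0 < θ)
    (hθS : θ < Real.logb 2 ((4 : ℝ) / 3) / (1 - Real.logb 2 ((4 : ℝ) / 3))) :
    SubexpSaturation ↔ ∀ c : ℝ, 0 < c → ∃ t₀ : ℝ, t₀ < 1 ∧ ∀ t : ℝ, t₀ ≤ t → t < 1 →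
      ∀ F : SpectralMap ℂ, IsUniversalSpectralPoint ℂ F →
        specMMPoint ℂ F 1 < Real.exp (-(θ * c / (1 - t))) →
          t * specMMPoint ℂ F 1 ≤
            (1 - specMMPoint ℂ F 0) + Real.exp (c / (1 - t)) * (1 - specMMPoint ℂ F 2) :=
  subexpSaturation_iff_roofBelowCeiling_of_rateBeyond hθ (rateBeyond_isolatedTower ℂ hθS)

/-! ## §6 The convexity chord of the thin excess -/

/-- ★ **CONVEXITY CHORD** (every field; Lotti–Romani joint convexity of `ω`): if the roof `(t₀,R)` holds,
`ω(1,t₀,R) ≤ 1+R` (`0 ≤ t₀ < 1`, `R ≥ 0`), then for `t ∈ [t₀,1]`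
`e(t,R) ≤ ((t−t₀)/(1−t₀))·e(1,R)`, since `(1,t,R) = a·(1,t₀,R) + b·(1,1,R)` with `a = (1−t)/(1−t₀)`,
`b = (t−t₀)/(1−t₀)`. [cite: LottiRomani1983, §1 (p. 173)] -/
theorem excess_le_chord {t₀ t R : ℝ} (ht₀ : 0 ≤ t₀) (ht₀1 : t₀ < 1) (ht : t₀ ≤ t) (ht1 : t ≤ 1) (hR : 0 ≤ R)
    (hroof : omegaRect K 1 t₀ R ≤ 1 + R) :
    omegaRect K 1 t R - (1 + R) ≤ (t - t₀) / (1 - t₀) * (omegaRect K 1 1 R - (1 + R)) := by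
  have hs : 0 < 1 - t₀ := sub_pos.2 ht₀1
  set a : ℝ := (1 - t) / (1 - t₀) with ha
  set b : ℝ := (t - t₀) / (1 - t₀) with hb
  have ha0 : 0 ≤ a := div_nonneg (sub_nonneg.2 ht1) hs.le
  have hb0 : 0 ≤ b := div_nonneg (sub_nonneg.2 ht) hs.le
  have hab : a + b = 1 := by
    rw [ha, hb, ← add_div, div_eq_one_iff_eq hs.ne']
    ring
  have h := LottiRomani1983_convexComb_le K (x := 1) (y := t₀) (z := R) (x' := 1) (y' := 1) (z' := R)
    zero_le_one ht₀ hR zero_le_one zero_le_one hR ha0 hb0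
  have e1 : a * 1 + b * 1 = 1 := by rw [mul_one, mul_one, hab]
  have e2 : a * t₀ + b * 1 = t := by
    rw [ha, hb, mul_one, div_mul_eq_mul_div, ← add_div, div_eq_iff hs.ne']
    ring
  have e3 : a * R + b * R = R := by rw [← add_mul, hab, one_mul]
  rw [e1, e2, e3] at h
  have h1 : a * omegaRect K 1 t₀ R ≤ a * (1 + R) := mul_le_mul_of_nonneg_left hroof ha0
  have h2 : a * (1 + R) + b * omegaRect K 1 1 R = (1 + R) + b * (omegaRect K 1 1 R - (1 + R)) := by
    have : a = 1 - b := by linarith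
    rw [this]; ring
  linarith

/-- **Chord from a roof family, parametrised by the length** (every field): if the roofs `(t, e^{c'/(1−t)})` hold
for all `t ∈ [t₀,1)` (`0 ≤ t₀ < 1`, `c' > 0`), then for every `R ≥ max (e^{c'/(1−t₀)}) (e)`... precisely for
`R > 1` with `1 − c'/log R ≥ t₀`, and every `t ∈ [1 − c'/log R, 1]`:
`e(t,R) ≤ (1 − (1−t)·log R/c')·e(1,R)` (the chord from the roof point `t' = 1 − c'/log R`, where `e^{c'/(1−t')} = R`).
[cite: LottiRomani1983, §1 (p. 173)] [cite: Strassen1988, Thm. 3.8] -/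
theorem excess_le_chord_of_roofFamily {c' t₀ : ℝ} (hc' : 0 < c') (ht₀ : 0 ≤ t₀)
    (h : ∀ t : ℝ, t₀ ≤ t → t < 1 → ∀ F : SpectralMap K, IsUniversalSpectralPoint K F →
      t * specMMPoint K F 1 ≤ (1 - specMMPoint K F 0) + Real.exp (c' / (1 - t)) * (1 - specMMPoint K F 2))
    {R : ℝ} (hR : 1 < R) (hRt : t₀ ≤ 1 - c' / Real.log R) {t : ℝ} (ht : 1 - c' / Real.log R ≤ t) (ht1 : t ≤ 1) :
    omegaRect K 1 t R - (1 + R) ≤ (1 - (1 - t) * Real.log R / c') * (omegaRect K 1 1 R - (1 + R)) := by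
  have hlog : 0 < Real.log R := Real.log_pos hR
  have hR0 : 0 ≤ R := by linarith
  set t' : ℝ := 1 - c' / Real.log R with ht'
  have hs' : 1 - t' = c' / Real.log R := by rw [ht']; ring
  have ht'1 : t' < 1 := by
    have : 0 < c' / Real.log R := div_pos hc' hlog
    linarith
  have ht'0 : 0 ≤ t' := le_trans ht₀ hRt
  have hexp : Real.exp (c' / (1 - t')) = R := by
    rw [hs', div_div_cancel₀ hc'.ne', Real.exp_log (by linarith)]
  have hroof : omegaRect K 1 t' R ≤ 1 + R := by
    refine (thinTight_iff_roof (K := K) ht'0 hR0).2 fun F hF => ?_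
    have := h t' hRt ht'1 F hF
    rwa [hexp] at this
  have hch := excess_le_chord ht'0 ht'1 ht ht1 hR0 hroof
  have e : (t - t') / (1 - t') = 1 - (1 - t) * Real.log R / c' := by
    rw [hs', ht']
    field_simp
    ring
  rwa [e] at hch

/-- ★ **The thin excess along the crux's curve is at most the fraction `1 − c/c'` of the far excess** (over `ℂ`):
for every `c' > c₂ = (5 log(5/4) + 3 log 2)/3 = 1.0650…` (the class ceiling, above which the corner roof is a
THEOREM — file 3's `cornerRoof_above_classCeiling`) there is `R₀ > 1` such that for all `R ≥ R₀` and
`t ∈ [1 − c'/log R, 1]`: `e(t,R) ≤ (1 − (1−t)·log R/c')·e(1,R)`; at `R = e^{c/(1−t)}`, `c < c'`, the factor is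
`1 − c/c'`. [cite: CoppersmithWinograd1990, §8] [cite: LottiRomani1983, §1 (p. 173)] [cite: Strassen1988, Thm. 3.8] -/
theorem thinExcess_le_classChord {c' : ℝ} (hc' : (5 * Real.log (5 / 4) + 3 * Real.log 2) / 3 < c') :
    ∃ R₀ : ℝ, 1 < R₀ ∧ ∀ R : ℝ, R₀ ≤ R → ∀ t : ℝ, 1 - c' / Real.log R ≤ t → t ≤ 1 →
      omegaRect ℂ 1 t R - (1 + R) ≤ (1 - (1 - t) * Real.log R / c') * (omegaRect ℂ 1 1 R - (1 + R)) := by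
  have hc2 : 0 < (5 * Real.log (5 / 4) + 3 * Real.log 2) / 3 := by
    have h1 : 0 < Real.log (5 / 4) := Real.log_pos (by norm_num)
    have h2 : 0 < Real.log 2 := Real.log_pos (by norm_num)
    positivity
  have hc'0 : 0 < c' := lt_trans hc2 hc'
  obtain ⟨t₀, ht₀1, h⟩ := cornerRoof_above_classCeiling c' hc'
  -- make the threshold non-negative
  set t₁ : ℝ := max t₀ 0 with ht₁
  have ht₁0 : 0 ≤ t₁ := le_max_right _ _
  have ht₁1 : t₁ < 1 := max_lt ht₀1 one_pos
  have h' : ∀ t : ℝ, t₁ ≤ t → t < 1 → ∀ F : SpectralMap ℂ, IsUniversalSpectralPoint ℂ F →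
      t * specMMPoint ℂ F 1 ≤ (1 - specMMPoint ℂ F 0) + Real.exp (c' / (1 - t)) * (1 - specMMPoint ℂ F 2) :=
    fun t ht ht1 F hF => h t (le_trans (le_max_left _ _) ht) ht1 F hF
  refine ⟨max (Real.exp (c' / (1 - t₁))) (Real.exp 1), ?_, fun R hR t ht ht1 => ?_⟩
  · exact lt_of_lt_of_le (by have := Real.add_one_le_exp (1 : ℝ); linarith) (le_max_right _ _)
  · have hRe : Real.exp 1 ≤ R := le_trans (le_max_right _ _) hR
    have hR1 : 1 < R := lt_of_lt_of_le (by have := Real.add_one_le_exp (1 : ℝ); linarith) hRe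
    have hlog : 0 < Real.log R := Real.log_pos hR1
    have hs₁ : 0 < 1 - t₁ := sub_pos.2 ht₁1
    have hRt : t₁ ≤ 1 - c' / Real.log R := by
      -- `exp(c'/(1−t₁)) ≤ R` ⟹ `c'/(1−t₁) ≤ log R` ⟹ `c'/log R ≤ 1 − t₁`
      have h1 : Real.exp (c' / (1 - t₁)) ≤ R := le_trans (le_max_left _ _) hR
      have h2 : c' / (1 - t₁) ≤ Real.log R := by
        rw [← Real.log_exp (c' / (1 - t₁))]
        exact Real.log_le_log (Real.exp_pos _) h1
      have h3 : c' / Real.log R ≤ 1 - t₁ := by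
        rw [div_le_iff₀ hlog]
        rw [div_le_iff₀ hs₁] at h2
        linarith
      linarith
    exact excess_le_chord_of_roofFamily hc'0 ht₁0 h' hR1 hRt ht ht1

end Summit.MatrixMultiplication.MatrixMultiplication.Theorems.SaturationLadderHeightExcess

end
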